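import Summits.AtomisticToContinuum.BoseEinsteinCondensation.Theorems.BECInsertionCorrectorCorrectorClosureZeroModeFSumCommutator
import HarnessLib

/-!
# The zero-mode f-sum bound, III: the first moment `m₁(N̂₀) = 𝓔_{|Φ|}(g, g)` of a minimiser through the
# Euler–Lagrange equation (line `volume-homotopy-sum-rule-domination`, helpers for the registered stub
# `stub_zeroModeFSum`, crux `BECInsertionCorrector.CorrectorClosure`, item stmt-AtomisticToContinuum-12058)

Supports (does not close) stmt-AtomisticToContinuum-12058. For a real positive finite-energy minimiser
`Φ` of `n + 2` bosons (`F = |Φ|`, `E = E_v(Φ) = E₀(n+2, L)`), the slot averages `uⱼ = PⱼF`, the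
zero-mode counting amplitude `u = N̂₀F = ∑ⱼuⱼ`, its slot-`0` average `W = P₀u` (bath form) and the
counting ratio `g = u/F` (all as hypotheses `hF`, `huu`, `hu`, `hW`, `hg`; no new definitions):

1. `zf_dirichlet_eq_firstMoment` (ground-state representation): `g` is a periodic test function and
   `𝓔_F(g,g) = ∫|∇u|² + ∫Vu² − E∫u² = ⟨u,(H−E)u⟩` — the weak Euler–Lagrange equation for all periodic
   `C¹` tests (`tilt_el_all`) on `ζ = g²` and the Jacobi identity `|∇(gF)|² = ∇F·∇(g²F) + |∇g|²F²`;
2. `zf_firstMoment_symm` (Bose symmetry): `⟨u,(H−E)u⟩ = (n+2)⟨u₀,(H−E)u⟩`;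
3. `zf_firstMoment_slot_zero` (`[T,P₀] = 0`, `P₀ = P₀*`, E–L on `ζ = (W∘tail)/F`):
   `∫∇u₀·∇u − E∫u₀u = −∫VF(W∘tail)`, i.e. `⟨u₀,(H−E)u⟩ = ⟨u₀,Vu⟩ − ⟨VF,P₀u⟩ = ⟨F,[P₀,V]u⟩`;
4. `zf_pot_reduction` (`[P₀, v_{kl}] = 0` for `k,l ≥ 1`, relabelling `(1 l)`):
   `⟨u₀,Vu⟩ − ⟨VF,P₀u⟩ = (n+1)(⟨u₀,v₀₁u⟩ − ⟨v₀₁F,P₀u⟩)`, `v₀₁ = v^per(x₀ − x₁)`.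

The pair `(0,1)` is bounded and the stub assembled in `…ZeroModeFSum.lean`.

References: [ReedSimonIV1978] M. Reed, B. Simon, *Methods of Modern Mathematical Physics IV*, §XIII.1
(Rayleigh–Ritz); [Stringari1995] S. Stringari, *Sum rules and Bose–Einstein condensation*, §2.3;
[PitaevskiiStringari1991] L. Pitaevskii, S. Stringari, J. Low Temp. Phys. 85 (1991), (9).
-/

noncomputable section

namespace Summit.AtomisticToContinuum.BoseEinsteinCondensation.Theorems.CorrectorClosure.VolumeHomotopySumRuleDomination

open MeasureTheory Filter Matrix
open scoped ENNReal NNReal BigOperators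
open Literature.MathematicalPhysics.QuantumManyBody.BoseGas
open Summit.AtomisticToContinuum.BoseEinsteinCondensation.Theorems.CorrectorClosure.GeometricMeanCorrector
  (tilt_el_all tilt_toReal_periodicInteraction_succ tilt_gradDot_finset_sum_right tilt_gradDot_comp_perm₂
    tilt_contDiff_comp_tail mixedLaw_continuous_tail)
open Summit.AtomisticToContinuum.BoseEinsteinCondensation.Theorems.CorrectorClosure.HealingScaleKacInsertion.ResponseDictionary
  (setIntegral_cellN_comp_perm)
open Summit.AtomisticToContinuum.BoseEinsteinCondensation.Theorems.CorrectorClosure.ZeroModeRemovalSusceptibility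
  (reb_isLatticePeriodic_tail)
open Summit.AtomisticToContinuum.BoseEinsteinCondensation.Cruxes.StaticResponseBound.UvThomsonForceWave
  (contDiff_norm_of_real gradDot_mul_self_eq)
open Summit.AtomisticToContinuum.BoseEinsteinCondensation.Theorems.PositiveMinimiser
  (contDiff_toReal_periodizedPotential contDiff_toReal_periodicInteraction exists_periodizedPotential_le)

variable {n : ℕ} {L : ℝ}

/-! ### The modulus `F = |Φ|` of a real positive state -/

/-- `F = |Φ|` is a periodic test function for a real nonnegative state `Φ`. [folklore] -/
theorem zf_F_isPeriodicTest (Φ : PeriodicTrialState (n + 2) L) (hreal : ∀ X, Φ.ψ X = (‖Φ.ψ X‖ : ℂ))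
    {F : Config (n + 2) → ℝ} (hF : ∀ X, ‖Φ.ψ X‖ = F X) : IsPeriodicTest L F := by
  have h : (fun X => ‖Φ.ψ X‖) = F := funext hF
  rw [← h]
  exact ⟨contDiff_norm_of_real Φ hreal, fun X i k => by dsimp only; rw [Φ.periodic]⟩

/-- `F = |Φ|` is Bose symmetric. [folklore] -/
theorem zf_F_symm (Φ : PeriodicTrialState (n + 2) L) {F : Config (n + 2) → ℝ}
    (hF : ∀ X, ‖Φ.ψ X‖ = F X) (σ : Equiv.Perm (Fin (n + 2))) (X : Config (n + 2)) :
    F (X ∘ σ) = F X := by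
  rw [← hF, ← hF, Φ.symm]

/-- `F = |Φ| > 0` for a nowhere-vanishing state. [folklore] -/
theorem zf_F_pos (Φ : PeriodicTrialState (n + 2) L) (hpos : ∀ X, Φ.ψ X ≠ 0)
    {F : Config (n + 2) → ℝ} (hF : ∀ X, ‖Φ.ψ X‖ = F X) (X : Config (n + 2)) : 0 < F X := by
  rw [← hF]
  exact norm_pos_iff.2 (hpos X)

/-- `‖F‖² = ∫_{cell} |Φ|² = 1`. [folklore] -/
theorem zf_integral_F_sq (Φ : PeriodicTrialState (n + 2) L) {F : Config (n + 2) → ℝ}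
    (hF : ∀ X, ‖Φ.ψ X‖ = F X) : ∫ X in cellN (n + 2) L, F X ^ 2 = 1 := by
  -- adapted from `…GaussianDominationCanDensityWaveKinematic` (the real form of `Φ.norm_eq`)
  have hint : Integrable (fun X => ‖Φ.ψ X‖ ^ 2) (volume.restrict (cellN (n + 2) L)) :=
    integrableOn_cellN ((Φ.contDiff.continuous.norm).pow 2) L
  have h := ofReal_integral_eq_lintegral_ofReal hint (Filter.Eventually.of_forall fun X => sq_nonneg _)
  simp_rw [← coe_nnnorm_sq_eq_ofReal] at h
  rw [Φ.norm_eq] at h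
  have hnn : 0 ≤ ∫ X in cellN (n + 2) L, ‖Φ.ψ X‖ ^ 2 := integral_nonneg fun X => sq_nonneg _
  have h1 := congrArg ENNReal.toReal h
  rw [ENNReal.toReal_ofReal hnn, ENNReal.toReal_one] at h1
  simpa only [hF] using h1

/-! ### Step 1: ground-state representation `𝓔_F(g, g) = ⟨u, (H − E)u⟩` -/

/-- **Ground-state representation of the f-sum.** For a real positive finite-energy minimiser `Φ`
(`F = |Φ|`, `E = E_v(Φ) = E₀`) and a periodic test function `u`, the ratio `g = u/F` is a periodic
test function and `𝓔_F(g,g) = ∫|∇u|² + ∫ V u² − E ∫ u²` (the E–L equation `tilt_el_all` on `ζ = g²`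
and the Jacobi identity `|∇(gF)|² = ∇F·∇(g²F) + |∇g|²F²`).
[cite: ReedSimonIV1978, §XIII.1 (Rayleigh–Ritz)] -/
theorem zf_dirichlet_eq_firstMoment {v : ℝ → ℝ≥0∞} (hvm : Measurable v)
    (Φ : PeriodicTrialState (n + 2) L) (hreal : ∀ X, Φ.ψ X = (‖Φ.ψ X‖ : ℂ)) (hpos : ∀ X, Φ.ψ X ≠ 0)
    (hE : periodicEnergy v Φ = periodicGroundStateEnergy v (n + 2) L) (hEfin : periodicEnergy v Φ ≠ ⊤)
    {F : Config (n + 2) → ℝ} (hF : ∀ X, ‖Φ.ψ X‖ = F X) {u : Config (n + 2) → ℝ}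
    (hut : IsPeriodicTest L u) {g : Config (n + 2) → ℝ} (hg : ∀ X, g X = u X / F X) :
    IsPeriodicTest L g ∧
      dirichletFormW L F g g = (∫ X in cellN (n + 2) L, gradDot u u X) +
        (∫ X in cellN (n + 2) L, (periodicInteraction v L X).toReal * u X ^ 2) -
        (periodicEnergy v Φ).toReal * ∫ X in cellN (n + 2) L, u X ^ 2 := by
  -- adapted from `stub_removalEnergyBudget` (RemovalEnergyBudget), step (iii)
  have hFt := zf_F_isPeriodicTest Φ hreal hF
  have hF0 := zf_F_pos Φ hpos hF
  have hgfun : g = fun X => u X / F X := funext hg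
  have hgt : IsPeriodicTest L g := by
    rw [hgfun]
    exact ⟨hut.1.div hFt.1 fun X => (hF0 X).ne', fun X i k => by simp only [hut.2, hFt.2]⟩
  refine ⟨hgt, ?_⟩
  have hgd : Differentiable ℝ g := hgt.differentiable
  have hFd : Differentiable ℝ F := hFt.differentiable
  have hgF : ∀ X, g X * F X = u X := fun X => by rw [hg]; exact div_mul_cancel₀ _ (hF0 X).ne'
  have hg2 : ∀ X, g X ^ 2 * F X ^ 2 = u X ^ 2 := fun X => by rw [← mul_pow, hgF]
  have hζC : ContDiff ℝ 1 fun Y => g Y ^ 2 := hgt.1.pow 2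
  have hζper : IsLatticePeriodic L fun Y => g Y ^ 2 := fun X i k => by
    show g (X + _) ^ 2 = g X ^ 2
    rw [hgt.2]
  have hel : (∫ X in cellN (n + 2) L, gradDot F (fun Y => g Y ^ 2 * F Y) X) +
      (∫ X in cellN (n + 2) L, (periodicInteraction v L X).toReal * u X ^ 2) =
      (periodicEnergy v Φ).toReal * ∫ X in cellN (n + 2) L, u X ^ 2 := by
    have h := tilt_el_all (M := n + 2) hvm hreal hE hEfin hζC hζper
    simp only [hF] at h
    have e2 : ∫ X in cellN (n + 2) L, (periodicInteraction v L X).toReal * g X ^ 2 * F X ^ 2 =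
        ∫ X in cellN (n + 2) L, (periodicInteraction v L X).toReal * u X ^ 2 :=
      integral_congr_ae (ae_of_all _ fun X => by dsimp only; rw [mul_assoc, hg2])
    have e3 : ∫ X in cellN (n + 2) L, g X ^ 2 * F X ^ 2 = ∫ X in cellN (n + 2) L, u X ^ 2 :=
      integral_congr_ae (ae_of_all _ fun X => hg2 X)
    rw [e2, e3] at h
    exact h
  have hufun : (fun Y => g Y * F Y) = u := funext hgF
  have hpt : ∀ X, gradDot g g X * F X ^ 2 =
      gradDot u u X - gradDot F (fun Y => g Y ^ 2 * F Y) X := by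
    intro X
    have h := gradDot_mul_self_eq (hgd X) (hFd X)
    rw [hufun] at h
    linarith
  have iuu : IntegrableOn (fun X => gradDot u u X) (cellN (n + 2) L) :=
    integrableOn_cellN (continuous_gradDot hut.1 hut.1) L
  have iFζ : IntegrableOn (fun X => gradDot F (fun Y => g Y ^ 2 * F Y) X) (cellN (n + 2) L) :=
    integrableOn_cellN (continuous_gradDot hFt.1 (hζC.mul hFt.1)) L
  have hDir : dirichletFormW L F g g = (∫ X in cellN (n + 2) L, gradDot u u X) -
      ∫ X in cellN (n + 2) L, gradDot F (fun Y => g Y ^ 2 * F Y) X := by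
    rw [dirichletFormW, integral_congr_ae (ae_of_all _ hpt), integral_sub iuu iFζ]
  rw [hDir]
  linarith

/-! ### Step 2: Bose symmetry `⟨u, (H − E)u⟩ = N ⟨u₀, (H − E)u⟩` -/

/-- **Bose symmetry of the first moment.** For a continuous symmetric weight `V`, a symmetric periodic
test function `F` with slot averages `uⱼ` and `u = ∑ⱼ uⱼ`, and any real `E`:
`∫|∇u|² + ∫Vu² − E∫u² = (n+2)(∫∇u₀·∇u + ∫V u₀u − E∫u₀u)` (linearity in the first slot and the
relabelling `uⱼ = u₀∘(·∘(0 j))`, `u`, `V`, the cell and Lebesgue measure being invariant). [folklore] -/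
theorem zf_firstMoment_symm (hL : 0 < L) {V : Config (n + 2) → ℝ} (hVc : Continuous V)
    (hVsymm : ∀ (σ : Equiv.Perm (Fin (n + 2))) (X : Config (n + 2)), V (X ∘ σ) = V X)
    {F : Config (n + 2) → ℝ} (hFt : IsPeriodicTest L F)
    (hFsymm : ∀ (σ : Equiv.Perm (Fin (n + 2))) (X : Config (n + 2)), F (X ∘ σ) = F X)
    {uu : Fin (n + 2) → Config (n + 2) → ℝ}
    (huu : ∀ m X, uu m X = (L ^ 3)⁻¹ * ∫ y in cell L, F (Function.update X m y))
    {u : Config (n + 2) → ℝ} (hu : ∀ X, u X = ∑ m, uu m X) (E : ℝ) :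
    (∫ X in cellN (n + 2) L, gradDot u u X) + (∫ X in cellN (n + 2) L, V X * u X ^ 2) -
        E * ∫ X in cellN (n + 2) L, u X ^ 2 =
      ((n : ℝ) + 2) * ((∫ X in cellN (n + 2) L, gradDot (uu 0) u X) +
        (∫ X in cellN (n + 2) L, V X * (uu 0 X * u X)) - E * ∫ X in cellN (n + 2) L, uu 0 X * u X) := by
  have huut : ∀ m, IsPeriodicTest L (uu m) := zf_isPeriodicTest_uu hL hFt hFsymm huu
  have hut : IsPeriodicTest L u := zf_isPeriodicTest_u hL hFt hFsymm huu hu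
  have husymm := zf_u_comp_perm hFsymm huu hu
  -- relabelling: every slot contributes the same
  have hrel : ∀ m : Fin (n + 2),
      (∫ X in cellN (n + 2) L, gradDot (uu m) u X) = (∫ X in cellN (n + 2) L, gradDot (uu 0) u X) ∧
      (∫ X in cellN (n + 2) L, V X * (uu m X * u X)) = (∫ X in cellN (n + 2) L, V X * (uu 0 X * u X)) ∧
      (∫ X in cellN (n + 2) L, uu m X * u X) = ∫ X in cellN (n + 2) L, uu 0 X * u X := by
    intro m
    have hm : ∀ X, uu m X = uu 0 (X ∘ Equiv.swap 0 m) := zf_uu_eq_comp_swap hFsymm huu m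
    have hmfun : uu m = fun X => uu 0 (X ∘ Equiv.swap 0 m) := funext hm
    have hufun : u = fun X => u (X ∘ Equiv.swap 0 m) := funext fun X => (husymm _ X).symm
    refine ⟨?_, ?_, ?_⟩
    · have hpt : ∀ X, gradDot (uu m) u X = gradDot (uu 0) u (X ∘ Equiv.swap 0 m) := by
        intro X
        have h := tilt_gradDot_comp_perm₂ (huut 0).differentiable hut.differentiable (Equiv.swap 0 m) X
        rw [← hufun, ← hmfun] at h
        exact h
      rw [integral_congr_ae (ae_of_all _ hpt)]
      exact setIntegral_cellN_comp_perm L (Equiv.swap 0 m) (fun X => gradDot (uu 0) u X)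
    · have hpt : ∀ X, V X * (uu m X * u X) =
          (fun Y => V Y * (uu 0 Y * u Y)) (X ∘ Equiv.swap 0 m) := fun X => by
        dsimp only
        rw [hVsymm, husymm, ← hm]
      rw [integral_congr_ae (ae_of_all _ hpt)]
      exact setIntegral_cellN_comp_perm L (Equiv.swap 0 m) (fun Y => V Y * (uu 0 Y * u Y))
    · have hpt : ∀ X, uu m X * u X = (fun Y => uu 0 Y * u Y) (X ∘ Equiv.swap 0 m) := fun X => by
        dsimp only
        rw [husymm, ← hm]
      rw [integral_congr_ae (ae_of_all _ hpt)]
      exact setIntegral_cellN_comp_perm L (Equiv.swap 0 m) (fun Y => uu 0 Y * u Y)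
  -- linearity in the first slot
  have hufun : u = fun Y => ∑ m, uu m Y := funext hu
  have hsum1 : (∫ X in cellN (n + 2) L, gradDot u u X) =
      ∑ m, ∫ X in cellN (n + 2) L, gradDot (uu m) u X := by
    have hpt : ∀ X, gradDot u u X = ∑ m, gradDot (uu m) u X := by
      intro X
      have h1 : gradDot u u X = gradDot u (fun Y => ∑ m, uu m Y) X := by rw [← hufun]
      rw [h1, tilt_gradDot_finset_sum_right _ _ (fun m _ => (huut m).differentiable X)]
      exact Finset.sum_congr rfl fun m _ => gradDot_comm _ _ _
    rw [integral_congr_ae (ae_of_all _ hpt), integral_finsetSum _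
      (fun m _ => integrableOn_cellN (continuous_gradDot (huut m).1 hut.1) L)]
  have hsum2 : (∫ X in cellN (n + 2) L, V X * u X ^ 2) =
      ∑ m, ∫ X in cellN (n + 2) L, V X * (uu m X * u X) := by
    have hpt : ∀ X, V X * u X ^ 2 = ∑ m, V X * (uu m X * u X) := fun X => by
      rw [sq, ← Finset.mul_sum, ← Finset.sum_mul, ← hu]
    rw [integral_congr_ae (ae_of_all _ hpt), integral_finsetSum Finset.univ
      (f := fun m X => V X * (uu m X * u X))
      (fun m _ => integrableOn_cellN (hVc.mul ((huut m).continuous.mul hut.continuous)) L)]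
  have hsum3 : (∫ X in cellN (n + 2) L, u X ^ 2) = ∑ m, ∫ X in cellN (n + 2) L, uu m X * u X := by
    have hpt : ∀ X, u X ^ 2 = ∑ m, uu m X * u X := fun X => by
      rw [sq, ← Finset.sum_mul, ← hu]
    rw [integral_congr_ae (ae_of_all _ hpt), integral_finsetSum Finset.univ
      (f := fun m X => uu m X * u X)
      (fun m _ => integrableOn_cellN ((huut m).continuous.mul hut.continuous) L)]
  rw [hsum1, hsum2, hsum3]
  simp only [(hrel _).1, (hrel _).2.1, (hrel _).2.2, Finset.sum_const, Finset.card_univ,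
    Fintype.card_fin, nsmul_eq_mul]
  push_cast
  ring

/-! ### Step 3: `[T, P₀] = 0`, `P₀ = P₀*` and Euler–Lagrange on `ζ = (P₀u)/F` -/

/-- **The slot-`0` first moment through the Euler–Lagrange equation.** With `W = P₀u` (bath form):
`∫∇u₀·∇u − E∫u₀u = −∫ V F (W∘tail)` — since `∫∇u₀·∇u = ∫∇F·∇(W∘tail)` (`[T,P₀] = 0`),
`∫u₀u = ∫F(W∘tail)` (`P₀ = P₀*`) and `∫∇F·∇(W∘tail) + ∫V F (W∘tail) = E∫F(W∘tail)` (E–L on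
`ζ = (W∘tail)/F`). [cite: ReedSimonIV1978, §XIII.1 (Rayleigh–Ritz)] -/
theorem zf_firstMoment_slot_zero (hL : 0 < L) {v : ℝ → ℝ≥0∞} (hvm : Measurable v)
    (Φ : PeriodicTrialState (n + 2) L) (hreal : ∀ X, Φ.ψ X = (‖Φ.ψ X‖ : ℂ)) (hpos : ∀ X, Φ.ψ X ≠ 0)
    (hE : periodicEnergy v Φ = periodicGroundStateEnergy v (n + 2) L) (hEfin : periodicEnergy v Φ ≠ ⊤)
    {F : Config (n + 2) → ℝ} (hF : ∀ X, ‖Φ.ψ X‖ = F X)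
    {uu : Fin (n + 2) → Config (n + 2) → ℝ}
    (huu : ∀ m X, uu m X = (L ^ 3)⁻¹ * ∫ y in cell L, F (Function.update X m y))
    {u : Config (n + 2) → ℝ} (hu : ∀ X, u X = ∑ m, uu m X) {W : Config (n + 1) → ℝ}
    (hW : ∀ Y, W Y = (L ^ 3)⁻¹ * ∫ x in cell L, u (vecCons x Y)) :
    (∫ X in cellN (n + 2) L, gradDot (uu 0) u X) -
        (periodicEnergy v Φ).toReal * ∫ X in cellN (n + 2) L, uu 0 X * u X =
      -∫ X in cellN (n + 2) L, (periodicInteraction v L X).toReal * (F X * W (Fin.tail X)) := by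
  have hFt := zf_F_isPeriodicTest Φ hreal hF
  have hFsymm := zf_F_symm Φ hF
  have hF0 := zf_F_pos Φ hpos hF
  have hut : IsPeriodicTest L u := zf_isPeriodicTest_u hL hFt hFsymm huu hu
  have hWt : IsPeriodicTest L W := zf_avg_isPeriodicTest hL hut hW
  obtain ⟨G, hG⟩ : ∃ G : Config (n + 1) → ℝ, G = fun Y => (L ^ 3)⁻¹ * ∫ x in cell L, F (vecCons x Y) :=
    ⟨_, rfl⟩
  have hG' : ∀ Y, G Y = (L ^ 3)⁻¹ * ∫ x in cell L, F (vecCons x Y) := fun Y => by rw [hG]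
  have hK := zf_kinetic_uu_zero hL hFt huu hG' hut hW
  have hM := zf_mass_uu_zero hL hFt huu hG' hut.continuous hWt.continuous hW
  -- the Euler–Lagrange equation on `ζ = (W∘tail)/F`
  have hWT : ContDiff ℝ 1 fun X : Config (n + 2) => W (Fin.tail X) := tilt_contDiff_comp_tail hWt.1
  have hWTper : IsLatticePeriodic L fun X : Config (n + 2) => W (Fin.tail X) :=
    reb_isLatticePeriodic_tail hWt.2
  obtain ⟨ζ, hζ⟩ : ∃ ζ : Config (n + 2) → ℝ, ζ = fun X => W (Fin.tail X) / F X := ⟨_, rfl⟩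
  have hζC : ContDiff ℝ 1 ζ := by rw [hζ]; exact hWT.div hFt.1 fun X => (hF0 X).ne'
  have hζper : IsLatticePeriodic L ζ := by
    rw [hζ]
    intro X i k
    have h1 := hWTper X i k
    dsimp only at h1 ⊢
    rw [hFt.2, h1]
  have hζF : (fun Y => ζ Y * F Y) = fun Y => W (Fin.tail Y) := by
    funext Y; rw [hζ]; exact div_mul_cancel₀ _ (hF0 Y).ne'
  have hζF2 : ∀ X, ζ X * F X ^ 2 = F X * W (Fin.tail X) := fun X => by
    rw [hζ, sq, ← mul_assoc, div_mul_cancel₀ _ (hF0 X).ne', mul_comm]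
  have hel := tilt_el_all (M := n + 2) hvm hreal hE hEfin hζC hζper
  simp only [hF] at hel
  rw [hζF] at hel
  have e2 : ∫ X in cellN (n + 2) L, (periodicInteraction v L X).toReal * ζ X * F X ^ 2 =
      ∫ X in cellN (n + 2) L, (periodicInteraction v L X).toReal * (F X * W (Fin.tail X)) :=
    integral_congr_ae (ae_of_all _ fun X => by dsimp only; rw [mul_assoc, hζF2])
  have e3 : ∫ X in cellN (n + 2) L, ζ X * F X ^ 2 = ∫ X in cellN (n + 2) L, F X * W (Fin.tail X) :=
    integral_congr_ae (ae_of_all _ fun X => hζF2 X)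
  rw [e2, e3] at hel
  rw [hK, hM]
  linarith

/-! ### Step 4: `[P₀, v_{kl}] = 0` for `k, l ≥ 1` — only the pairs `(0, l)` survive -/

/-- **Reduction to the pair `(0,1)`.** `∫V u₀u − ∫VF(W∘tail) = (n+1)(∫v₀₁u₀u − ∫v₀₁F(W∘tail))`,
`v₀₁ = v^per(x₀ − x₁)`: split `V = ∑ⱼ v^per(x₀ − x_{j+1}) + V_bath∘tail`, the bath part cancels
(`zf_pot_uu_zero`), and every pair `(0, j+1)` is the pair `(0,1)` after the relabelling `(1 j+1)`,
which fixes `u₀`, `u`, `F` and `P₀u`. [folklore] -/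
theorem zf_pot_reduction (hL : 0 < L) {v : ℝ → ℝ≥0∞} {R₀ : ℝ} (hR : ∀ r, R₀ < r → v r = 0)
    (hfin : ∀ r, v r ≠ ⊤) (hC0 : Continuous fun x : Space => (v ‖x‖).toReal)
    {F : Config (n + 2) → ℝ} (hFt : IsPeriodicTest L F)
    (hFsymm : ∀ (σ : Equiv.Perm (Fin (n + 2))) (X : Config (n + 2)), F (X ∘ σ) = F X)
    {uu : Fin (n + 2) → Config (n + 2) → ℝ}
    (huu : ∀ m X, uu m X = (L ^ 3)⁻¹ * ∫ y in cell L, F (Function.update X m y))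
    {u : Config (n + 2) → ℝ} (hu : ∀ X, u X = ∑ m, uu m X) {W : Config (n + 1) → ℝ}
    (hW : ∀ Y, W Y = (L ^ 3)⁻¹ * ∫ x in cell L, u (vecCons x Y)) :
    (∫ X in cellN (n + 2) L, (periodicInteraction v L X).toReal * (uu 0 X * u X)) -
        ∫ X in cellN (n + 2) L, (periodicInteraction v L X).toReal * (F X * W (Fin.tail X)) =
      ((n : ℝ) + 1) *
        ((∫ X in cellN (n + 2) L, (periodizedPotential v L (X 0 - X 1)).toReal * (uu 0 X * u X)) -
          ∫ X in cellN (n + 2) L, (periodizedPotential v L (X 0 - X 1)).toReal * (F X * W (Fin.tail X))) := by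
  obtain ⟨C, hC⟩ := exists_periodizedPotential_le hL hR hfin hC0
  have hwc : Continuous fun x : Space => (periodizedPotential v L x).toReal :=
    (contDiff_toReal_periodizedPotential hL hR hfin (contDiff_zero.2 hC0)).continuous
  have hV'c : Continuous fun Y : Config (n + 1) => (periodicInteraction v L Y).toReal :=
    (contDiff_toReal_periodicInteraction hL hR hfin (contDiff_zero.2 hC0)).continuous
  have hsplit : ∀ X : Config (n + 2), (periodicInteraction v L X).toReal =
      (∑ j : Fin (n + 1), (periodizedPotential v L (X 0 - X j.succ)).toReal) +
        (periodicInteraction v L (Fin.tail X)).toReal := fun X => tilt_toReal_periodicInteraction_succ hC X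
  have huut : ∀ m, IsPeriodicTest L (uu m) := zf_isPeriodicTest_uu hL hFt hFsymm huu
  have hut : IsPeriodicTest L u := zf_isPeriodicTest_u hL hFt hFsymm huu hu
  have husymm := zf_u_comp_perm hFsymm huu hu
  have hWt : IsPeriodicTest L W := zf_avg_isPeriodicTest hL hut hW
  obtain ⟨G, hG⟩ : ∃ G : Config (n + 1) → ℝ, G = fun Y => (L ^ 3)⁻¹ * ∫ x in cell L, F (vecCons x Y) :=
    ⟨_, rfl⟩
  have hG' : ∀ Y, G Y = (L ^ 3)⁻¹ * ∫ x in cell L, F (vecCons x Y) := fun Y => by rw [hG]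
  have hQ1c : Continuous fun X => uu 0 X * u X := (huut 0).continuous.mul hut.continuous
  have hQ2c : Continuous fun X : Config (n + 2) => F X * W (Fin.tail X) :=
    hFt.continuous.mul (hWt.continuous.comp mixedLaw_continuous_tail)
  -- expansion of `∫ V Q` along the split of `V`
  have expand : ∀ {Q : Config (n + 2) → ℝ}, Continuous Q →
      ∫ X in cellN (n + 2) L, (periodicInteraction v L X).toReal * Q X =
        (∑ j : Fin (n + 1), ∫ X in cellN (n + 2) L,
            (periodizedPotential v L (X 0 - X j.succ)).toReal * Q X) +
          ∫ X in cellN (n + 2) L, (periodicInteraction v L (Fin.tail X)).toReal * Q X := by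
    intro Q hQ
    have hwjc : ∀ j : Fin (n + 1), Continuous fun X : Config (n + 2) =>
        (periodizedPotential v L (X 0 - X j.succ)).toReal * Q X :=
      fun j => (hwc.comp ((continuous_apply 0).sub (continuous_apply j.succ))).mul hQ
    have hVTc : Continuous fun X : Config (n + 2) => (periodicInteraction v L (Fin.tail X)).toReal * Q X :=
      (hV'c.comp mixedLaw_continuous_tail).mul hQ
    have hpt : ∀ X, (periodicInteraction v L X).toReal * Q X =
        (∑ j : Fin (n + 1), (periodizedPotential v L (X 0 - X j.succ)).toReal * Q X) +
          (periodicInteraction v L (Fin.tail X)).toReal * Q X := fun X => by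
      rw [hsplit X, add_mul, Finset.sum_mul]
    rw [integral_congr_ae (ae_of_all _ hpt),
      integral_add (integrable_finsetSum _ fun j _ => integrableOn_cellN (hwjc j) L)
        (integrableOn_cellN hVTc L),
      integral_finsetSum _ fun j _ => integrableOn_cellN (hwjc j) L]
  -- the bath part cancels
  have hbath : ∫ X in cellN (n + 2) L, (periodicInteraction v L (Fin.tail X)).toReal * (uu 0 X * u X) =
      ∫ X in cellN (n + 2) L, (periodicInteraction v L (Fin.tail X)).toReal * (F X * W (Fin.tail X)) := by
    have h := zf_pot_uu_zero hL hFt huu hG' hV'c hut.continuous hWt.continuous hW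
    simp only [mul_assoc] at h
    exact h
  -- every pair `(0, j+1)` is the pair `(0, 1)`
  have hrel : ∀ {Q : Config (n + 2) → ℝ},
      (∀ (τ : Equiv.Perm (Fin (n + 2))), τ 0 = 0 → ∀ X, Q (X ∘ τ) = Q X) → ∀ j : Fin (n + 1),
      ∫ X in cellN (n + 2) L, (periodizedPotential v L (X 0 - X j.succ)).toReal * Q X =
        ∫ X in cellN (n + 2) L, (periodizedPotential v L (X 0 - X 1)).toReal * Q X := by
    intro Q hQ j
    have hτ0 : Equiv.swap (1 : Fin (n + 2)) j.succ 0 = 0 :=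
      Equiv.swap_apply_of_ne_of_ne (Fin.zero_ne_one' (n := n + 1)) (Fin.succ_ne_zero j).symm
    have hτ1 : Equiv.swap (1 : Fin (n + 2)) j.succ 1 = j.succ := Equiv.swap_apply_left _ _
    rw [← setIntegral_cellN_comp_perm L (Equiv.swap (1 : Fin (n + 2)) j.succ)
      (fun X => (periodizedPotential v L (X 0 - X 1)).toReal * Q X)]
    refine integral_congr_ae (ae_of_all _ fun X => ?_)
    dsimp only
    rw [Function.comp_apply, Function.comp_apply, hτ0, hτ1, hQ _ hτ0]
  have hQ1 : ∀ (τ : Equiv.Perm (Fin (n + 2))), τ 0 = 0 → ∀ X, uu 0 (X ∘ τ) * u (X ∘ τ) = uu 0 X * u X :=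
    fun τ hτ X => by rw [zf_uu_comp_perm hFsymm huu, hτ, husymm]
  have hQ2 : ∀ (τ : Equiv.Perm (Fin (n + 2))), τ 0 = 0 → ∀ X,
      F (X ∘ τ) * W (Fin.tail (X ∘ τ)) = F X * W (Fin.tail X) :=
    fun τ hτ X => by rw [hFsymm, zf_avg_tail_comp_perm_of_fix husymm hW hτ]
  rw [expand hQ1c, expand hQ2c, hbath]
  simp only [hrel (Q := fun X => uu 0 X * u X) hQ1, hrel (Q := fun X => F X * W (Fin.tail X)) hQ2,
    Finset.sum_const, Finset.card_univ, Fintype.card_fin, nsmul_eq_mul]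
  push_cast
  ring

end Summit.AtomisticToContinuum.BoseEinsteinCondensation.Theorems.CorrectorClosure.VolumeHomotopySumRuleDomination

end
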